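import Mathlib.AlgebraicGeometry.Normalization
import Mathlib.AlgebraicGeometry.Morphisms.Finite
import Mathlib.AlgebraicGeometry.Noetherian
import HarnessLib

/-!
# The S₂-modification as the relative normalisation in the open complement: the chart-free facts — file L4c of the `S2Modification`
# discharge (crux `FInjectiveMacaulayfication` stmt-ResolutionOfSingularities-15315, chain w45a, hole #3γ/FC″, rung r2 input S-S2
# `FCForallExistsDimLe2.S2Modification`; res-L1-w45a-plan-1 R15.16 «L4 → stub-2»; seat res-L1-w45a-stub-2)

[OURS · L1 W4.5a] Support file (`--supports stmt-ResolutionOfSingularities-15315 --as helper`); NOT a statement of any manuscript; no named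
fact; no definitions; AI-written (AI review is weaker than expert review).

THE CONSTRUCTION. For an integral scheme `X` and a NON-EMPTY open `U ⊆ X` (`j = U.ι`), the S₂-modification of `X` along the closed
set `X ∖ U` (memo `D/res-D-pv-019/S2MOD-MEMO.md` §1: `Spec_X (ν_*𝒪_{X̄} ∩ j_*𝒪_U)`) is Mathlib's RELATIVE NORMALISATION OF `X` IN `U`:
`X₃ := j.normalization`, `g := j.fromNormalization : X₃ ⟶ X` (`Mathlib/AlgebraicGeometry/Normalization.lean`). This file proves the
properties of `g` that need no chart computation:

* `isIntegral_normalization_ι` — `X₃` is integral;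
* `isDominant_ι` / `surjective_fromNormalization` — `j` is dominant, hence so is `g`; `g` is integral, hence universally closed; so **`g`
  is surjective** (Mathlib `surjective_of_isDominant_of_isClosed_range`);
* `isIso_pullback_snd_fromNormalization` / `isIso_fromNormalization_restrict` — **`g` is an isomorphism over `U`**: normalisation commutes
  with the SMOOTH base change `j` (Mathlib `normalizationPullback`), and the normalisation of `U` in `U ×_X U = U` is `U`;
* `isIso_stalkMap_fromNormalization` — hence **`IsIso (g.stalkMap x₃)` for every `x₃` with `g x₃ ∈ U`** (the «stalk isomorphism off
  `F`» conjunct of `S2Modification`);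
* `isNoetherian_normalization` — `X₃` is Noetherian as soon as `X` is and `g` is locally of finite type (e.g. finite).

What is NOT here (chart computations, files L4a/L4b/L5/L3 and the coming assembly): `g` is FINITE (affine-locally `Spec` of
`integralClosure Γ(X, V) Γ(X, V ∩ U) ≅ s2Mod`, finite by E. Noether), and the Cohen–Macaulay / normality clauses at the points over
`X ∖ U`. [folklore] [cite: EGAIV2, 5.10.16–17]
-/

-- single-problem summit: the doubled namespace component is forced
set_option linter.dupNamespace false

noncomputable section

namespace Summit.ResolutionOfSingularities.ResolutionOfSingularities.Theorems.FInjectiveMacaulayfication.S2ModificationGlobal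

open CategoryTheory CategoryTheory.Limits AlgebraicGeometry TopologicalSpace Opposite

universe u

variable {X : Scheme.{u}} (U : X.Opens)

/-! ## §1 The open immersion `j : U ⟶ X` -/

/-- A non-empty open of an irreducible scheme is dense, so `U.ι` is dominant. [folklore] -/
theorem isDominant_ι [IrreducibleSpace X] [Nonempty U] : IsDominant U.ι := by
  refine AlgebraicGeometry.Opens.isDominant_ι ?_
  have hne : (U : Set X).Nonempty := by
    obtain ⟨x⟩ := ‹Nonempty U›
    exact ⟨x.1, x.2⟩
  exact U.2.dense hne

/-! ## §2 `X₃ := j.normalization` and `g := j.fromNormalization`: integrality, dominance, surjectivity, Noetherianity -/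

variable [QuasiCompact U.ι]

/-- `X₃ = j.normalization` is integral for `X` integral and `U` non-empty (Mathlib, from `IsIntegral U`). [folklore] -/
theorem isIntegral_normalization_ι [IsIntegral X] [Nonempty U] : IsIntegral U.ι.normalization :=
  inferInstance

/-- `g = j.fromNormalization` is dominant (`j = toNormalization ≫ g` is). [folklore] -/
theorem isDominant_fromNormalization [IrreducibleSpace X] [Nonempty U] : IsDominant U.ι.fromNormalization := by
  haveI := isDominant_ι U
  haveI : IsDominant (U.ι.toNormalization ≫ U.ι.fromNormalization) := by
    rw [Scheme.Hom.toNormalization_fromNormalization]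
    infer_instance
  exact IsDominant.of_comp U.ι.toNormalization _

/-- **`g = j.fromNormalization` is surjective**: dominant with closed image (an integral morphism is universally closed). [folklore] -/
theorem surjective_fromNormalization [IrreducibleSpace X] [Nonempty U] : Function.Surjective U.ι.fromNormalization.base := by
  haveI := isDominant_fromNormalization U
  haveI := surjective_of_isDominant_of_isClosed_range _ (U.ι.fromNormalization.isClosedMap.isClosed_range)
  exact U.ι.fromNormalization.surjective

/-- **`X₃` is Noetherian** when `X` is and `g` is locally of finite type (e.g. finite). [folklore] -/
theorem isNoetherian_normalization [IsNoetherian X] [LocallyOfFiniteType U.ι.fromNormalization] :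
    IsNoetherian U.ι.normalization := by
  haveI : IsLocallyNoetherian U.ι.normalization := LocallyOfFiniteType.isLocallyNoetherian U.ι.fromNormalization
  haveI : CompactSpace U.ι.normalization := QuasiCompact.compactSpace_of_compactSpace U.ι.fromNormalization
  exact {}

/-! ## §3 `g` is an isomorphism over `U` -/

/-- The second projection `U ×_X U ⟶ U` is an isomorphism (`j` is a monomorphism), hence so is the structure map of its relative
normalisation. [folklore] -/
theorem isIso_fromNormalization_pullback_snd : IsIso (pullback.snd U.ι U.ι).fromNormalization := by
  haveI : IsIso (pullback.snd U.ι U.ι).toNormalization := inferInstance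
  have h : (pullback.snd U.ι U.ι).toNormalization ≫ (pullback.snd U.ι U.ι).fromNormalization = pullback.snd U.ι U.ι :=
    Scheme.Hom.toNormalization_fromNormalization _
  exact IsIso.of_isIso_fac_left h

/-- **The base change of `g` to `U` is an isomorphism**: normalisation commutes with the smooth base change `j` (Mathlib
`normalizationPullback`). [folklore] -/
theorem isIso_pullback_snd_fromNormalization : IsIso (pullback.snd U.ι.fromNormalization U.ι) := by
  have h := Scheme.Hom.normalizationPullback_snd U.ι U.ι
  haveI : IsIso (U.ι.normalizationPullback U.ι ≫ pullback.snd U.ι.fromNormalization U.ι) := by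
    rw [h]
    exact isIso_fromNormalization_pullback_snd U
  exact IsIso.of_isIso_comp_left (U.ι.normalizationPullback U.ι) _

/-- **`g` restricted over `U` is an isomorphism.** [folklore] -/
theorem isIso_fromNormalization_restrict : IsIso (U.ι.fromNormalization ∣_ U) := by
  delta morphismRestrict
  haveI := isIso_pullback_snd_fromNormalization U
  infer_instance

/-- **`g` is an isomorphism on stalks at every point over `U`** — the conjunct «`g.stalkMap x₃` is an isomorphism for `g x₃ ∉ F`» of
`FCForallExistsDimLe2.S2Modification` (with `U = X ∖ F`). [folklore] [cite: EGAIV2, 5.10.16–17] -/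
theorem isIso_stalkMap_fromNormalization (x : ↥U.ι.normalization) (hx : U.ι.fromNormalization.base x ∈ U) :
    IsIso (U.ι.fromNormalization.stalkMap x) := by
  haveI := isIso_fromNormalization_restrict U
  let x' : ↥(U.ι.fromNormalization ⁻¹ᵁ U) := ⟨x, hx⟩
  have h : IsIso ((U.ι.fromNormalization ∣_ U).stalkMap x') := inferInstance
  exact ((MorphismProperty.isomorphisms CommRingCat).arrow_mk_iso_iff
    (morphismRestrictStalkMap U.ι.fromNormalization U x')).mp h

end Summit.ResolutionOfSingularities.ResolutionOfSingularities.Theorems.FInjectiveMacaulayfication.S2ModificationGlobal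

end
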